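import Summits.QuantumFields.YangMills.Theorems.UnitScaleTiltProp7SymCentreCentral
import HarnessLib

/-!
# Route `UnitScaleTilt`, crux K1 child «MinimiserStabilityRegPr» (stmt-QuantumFields-19200), stub `stub_existenceMinimalOrbit` (EX), line «SYM-CENTRE» (★★OWNER RULING
# g28-№7; line pen ★px20 g2) — **«Z2-NORMAL-FORM»: A COARSE FIELD WHOSE CLOSED-LOOP HOLONOMIES ARE CENTRAL IS A GAUGE TRANSFORM OF A CENTRAL-VALUED FIELD**, i.e. the
# supplier of the datum `hV : ∃ w S, (∀ c M, Commute ↑(S c) M) ∧ PlaqSmall δ S ∧ V = S^w` of ✓p673055 `Prop7SymCentreCentral.exists_symCentre_of_central_gauge` (★px6 g3,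
# case (a) «`p(V) = 3`» of ★px20 g2's LOCATE-SYM-CENTRE (V1)∕(V3)), and the end-to-end corollary at the `d = 3` family.

Cell `ym3-torus` (HUMAN RULING D-0037: YM₃ on T³ is ladder rung R3 — NOT d = 4, NOT a mass gap, NOT the Clay problem), width seat `ym-ust-19936-w2` gen 9 on ★px6 g3's
«Z2-NORMAL-FORM: YOURS» (22:29:37Z) within ★px20 g2's SYM-CENTRE line.  `--supports stmt-QuantumFields-19200 --as helper`; THEOREMS ONLY (0 `def`, 0 `sorry`, standard
axioms); count-neutral; nothing here claims `hSymCentre`, EX, the crux, the rung or the gap; the YM gap is NOT proved.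

THE POINT (no spanning tree needed).  Fix a base site `x₀` and for every site `x` the COMB WORD `Γ_x` (`stairWord 1 (label x − label x₀)`: all steps in direction `0`, then `1`, …;
`walkEnd x₀ Γ_x = x`, `walkEnd_combWord`).  The HOLONOMY GAUGE `u(x) := V(Γ_x)` turns every bond variable into a closed-loop holonomy:
`(V^u)(b) = V(Γ_{b₋})·V(b)·V(Γ_{b₊})⁻¹ = V(Γ_{b₋} ∪ b ∪ Γ_{b₊}⁻¹)` (`gaugeAct_combHol_apply`, `walkEnd_combLoop`).  So if every closed-walk holonomy at `x₀` is central, `S := V^u` is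
CENTRAL-VALUED, `PlaqSmall δ S` (gauge invariance, lit ✓`plaqSmall_gaugeAct_iff'`) and `V = S^{u⁻¹}` (`gaugeAct_inv_gaugeAct`) — ★★ `exists_gauge_centralValued_of_loopHol_central`
(generic `P : Params`, any level).  At the `d = 3` family (§4): ★★★ `exists_symCentre_of_loopHol_central` — for a coarse `V` with central holonomies and
`2`-small plaquettes, the fibre of `V` holds a printed-regular `U₀` (every radius `a > 0`), `b`-close in average, with `hLift` (every `Ū₀`-parallel coarse section lifts).
§3 is the «`p = 3` READING» of the hypothesis: ★`parallel_transport` (a `V`-parallel section is carried by the holonomy along every walk, `⋆`-form of px6's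
✓`parallel_iff_star`) and ★★`loopHol_central_of_parallel_span` — if the base values `c_i(x₀)` of a family of parallel sections SPAN `M₂(ℂ)` (e.g. `1` and three independent
traceless-Hermitian ones), `Ad_{V(γ)}` fixes the span for every closed walk `γ`, so every closed-walk holonomy is central = the datum `hcen`.  §4 composes with ✓p673055.
HONEST SCOPE.  Lattice-gauge bookkeeping on the tree's torus words (`T4Continuum.walk`∕`holAt`∕`stairWord`); NOTHING of [Balaban1985Averaging]'s estimates is asserted;
cases (b) `p = 1` (abelian smooth exact lift, ★px19 g3 ✓(R3) + ★px20 g2 (R4)) and (c) `p = 0` (✓p671081) are NOT touched.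

References: T. Bałaban, CMP **98** (1985) 17–51 [Balaban1985Averaging] ((8)–(12) p.19); CMP **109** (1987) 249–301 [Balaban1987RG1] ((0.3)–(0.4) pp.252–253).
-/

set_option autoImplicit false

noncomputable section

open scoped BigOperators Matrix.Norms.L2Operator

namespace Summit.QuantumFields.YangMills.Theorems.Prop7SymCentreCentralGauge

open Literature.MathematicalPhysics.QuantumFieldTheory.Balaban1983to89
open T4Continuum BlockAveraging
open T3UnitLawGaugeInvariance (gaugeAct_gaugeAct)
open T3PrintedRegularOrbits (plaqSmall_gaugeAct_iff')

/-! ## §1 The holonomy gauge along comb words (any gauge group, any level) -/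

section Comb

variable {P : Params} {j : ℕ} {G : Type*} [GaugeGroup G]

/-- The comb word from `x₀` to `x` (first direction `0`, then `1`, …; net displacement `label(x) − label(x₀)`) ends at `x`. [folklore] -/
theorem walkEnd_combWord (x₀ x : Site P j) :
    walkEnd x₀ (stairWord (1 : Equiv.Perm (Fin P.d)) (fun κ => ((x κ).val : ℤ) - ((x₀ κ).val : ℤ))) = x := by
  funext κ
  rw [walkEnd_apply, netDisp_stairWord]
  push_cast
  rw [ZMod.natCast_zmod_val, ZMod.natCast_zmod_val]
  ring

/-- **THE HOLONOMY GAUGE TURNS EVERY BOND VARIABLE INTO A CLOSED-LOOP HOLONOMY**: with `u(x) := U(comb from x₀ to x)`, the gauged variable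
`(U^u)(b) = u(b₋)·U(b)·u(b₊)⁻¹` is the holonomy of the closed walk `comb(b₋) ∪ b ∪ comb(b₊)⁻¹` based at `x₀`. [cite: Balaban1985Averaging, (8) p.19] -/
theorem gaugeAct_combHol_apply (U : GaugeField P j G) (x₀ : Site P j) (b : PBond P j) :
    GaugeField.gaugeAct (fun x => holAt U (walk x₀ (stairWord (1 : Equiv.Perm (Fin P.d)) (fun κ => ((x κ).val : ℤ) - ((x₀ κ).val : ℤ))))) U b =
      holAt U (walk x₀ (stairWord (1 : Equiv.Perm (Fin P.d)) (fun κ => ((b.src κ).val : ℤ) - ((x₀ κ).val : ℤ)) ++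
        ((b.dir, true) :: wordRev (stairWord (1 : Equiv.Perm (Fin P.d)) (fun κ => ((b.tgt κ).val : ℤ) - ((x₀ κ).val : ℤ)))))) := by
  rw [walk_append, holAt_append, walkEnd_combWord]
  show _ = _ * holAt U (⟨⟨b.src, b.dir⟩, true⟩ :: walk (b.src.shift b.dir) (wordRev _))
  rw [holAt_cons, if_pos rfl]
  have htgt : b.src.shift b.dir = walkEnd x₀ (stairWord (1 : Equiv.Perm (Fin P.d)) (fun κ => ((b.tgt κ).val : ℤ) - ((x₀ κ).val : ℤ))) := by
    rw [walkEnd_combWord]; rfl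
  rw [htgt, holAt_walk_wordRev]
  simp only [GaugeField.gaugeAct, mul_assoc]

/-- … and that closed walk indeed returns to `x₀`. [folklore] -/
theorem walkEnd_combLoop (x₀ : Site P j) (b : PBond P j) :
    walkEnd x₀ (stairWord (1 : Equiv.Perm (Fin P.d)) (fun κ => ((b.src κ).val : ℤ) - ((x₀ κ).val : ℤ)) ++
        ((b.dir, true) :: wordRev (stairWord (1 : Equiv.Perm (Fin P.d)) (fun κ => ((b.tgt κ).val : ℤ) - ((x₀ κ).val : ℤ))))) = x₀ := by
  rw [walkEnd_append, walkEnd_combWord]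
  show walkEnd (b.src.shift b.dir) (wordRev _) = x₀
  have htgt : b.src.shift b.dir = walkEnd x₀ (stairWord (1 : Equiv.Perm (Fin P.d)) (fun κ => ((b.tgt κ).val : ℤ) - ((x₀ κ).val : ℤ))) := by
    rw [walkEnd_combWord]; rfl
  rw [htgt, walkEnd_walkEnd_wordRev]

/-- Undoing a gauge transformation: `(U^u)^{u⁻¹} = U`. [cite: Balaban1985Averaging, (8) p.19] -/
theorem gaugeAct_inv_gaugeAct (u : GaugeTransf P j G) (U : GaugeField P j G) :
    GaugeField.gaugeAct (fun x => (u x)⁻¹) (GaugeField.gaugeAct u U) = U := by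
  rw [gaugeAct_gaugeAct]
  funext b
  simp [GaugeField.gaugeAct]

end Comb

/-! ## §2 `SU(2)`: central closed-loop holonomies ⇒ a gauge transform of a central-valued field (the «ℤ₂ normal form») -/

section Central

variable {P : Params} {j : ℕ}

/-- ★★ **«Z2-NORMAL-FORM»**: if every closed-walk holonomy of the `SU(2)` field `V` at one base site `x₀` is CENTRAL (commutes with every `2 × 2` matrix), then
`V = S^w` for a gauge transformation `w` and a field `S` ALL OF WHOSE BOND VARIABLES ARE CENTRAL, with the same plaquette smallness (`S := V^{u}` in the holonomy gauge `u`
of the comb words, whose variables are closed-loop holonomies, `gaugeAct_combHol_apply`; `w := u⁻¹`; `PlaqSmall` is gauge invariant, lit ✓`plaqSmall_gaugeAct_iff'`) — the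
datum `hV` of ✓`Prop7SymCentreCentral.exists_symCentre_of_central_gauge` VERBATIM. [cite: Balaban1985Averaging, (8)-(12) p.19] -/
theorem exists_gauge_centralValued_of_loopHol_central (V : GaugeField P j (Matrix.specialUnitaryGroup (Fin 2) ℂ)) (x₀ : Site P j)
    (hcen : ∀ w : List (Letter P.d), walkEnd x₀ w = x₀ →
      ∀ M : Matrix (Fin 2) (Fin 2) ℂ, Commute ((holAt V (walk x₀ w) : Matrix.specialUnitaryGroup (Fin 2) ℂ) : Matrix (Fin 2) (Fin 2) ℂ) M)
    {δ : ℝ} (hV : PlaqSmall δ V) :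
    ∃ (w : GaugeTransf P j (Matrix.specialUnitaryGroup (Fin 2) ℂ)) (S : GaugeField P j (Matrix.specialUnitaryGroup (Fin 2) ℂ)),
      (∀ (c : PBond P j) (M : Matrix (Fin 2) (Fin 2) ℂ), Commute ((S c : Matrix.specialUnitaryGroup (Fin 2) ℂ) : Matrix (Fin 2) (Fin 2) ℂ) M) ∧
      PlaqSmall δ S ∧ V = GaugeField.gaugeAct w S := by
  set u : GaugeTransf P j (Matrix.specialUnitaryGroup (Fin 2) ℂ) :=
    fun x => holAt V (walk x₀ (stairWord (1 : Equiv.Perm (Fin P.d)) (fun κ => ((x κ).val : ℤ) - ((x₀ κ).val : ℤ)))) with hu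
  refine ⟨fun x => (u x)⁻¹, GaugeField.gaugeAct u V, fun c M => ?_, (plaqSmall_gaugeAct_iff' δ u V).mpr hV, (gaugeAct_inv_gaugeAct u V).symm⟩
  rw [hu, gaugeAct_combHol_apply]
  exact hcen _ (walkEnd_combLoop x₀ c) M

end Central


/-! ## §3 The «p = 3» reading: parallel sections whose base values span `M₂(ℂ)` force central holonomies -/

section Reading

variable {P : Params} (V : GaugeField P 0 (Matrix.specialUnitaryGroup (Fin 2) ℂ))

/-- **PARALLEL TRANSPORT OF A PARALLEL SECTION ALONG A WALK**: if `c(e₋) = V(e)·c(e₊)·V(e)⋆` on every bond (the `⋆`-form of the tree's parallelism text, px6's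
✓`parallel_iff_star`), then `c(x) = V(γ)·c(end γ)·V(γ)⋆` for every walk `γ` from `x`. [cite: Balaban1985BackgroundPropagators, (3.21) p.394] -/
theorem parallel_transport {c : Site P 0 → Matrix (Fin 2) (Fin 2) ℂ}
    (hc : ∀ e : PBond P 0, c e.src = ((V e : Matrix.specialUnitaryGroup (Fin 2) ℂ) : Matrix (Fin 2) (Fin 2) ℂ) * c e.tgt *
      star ((V e : Matrix.specialUnitaryGroup (Fin 2) ℂ) : Matrix (Fin 2) (Fin 2) ℂ)) :
    ∀ (x : Site P 0) (w : List (Letter P.d)),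
      c x = ((holAt V (walk x w) : Matrix.specialUnitaryGroup (Fin 2) ℂ) : Matrix (Fin 2) (Fin 2) ℂ) * c (walkEnd x w) *
        star ((holAt V (walk x w) : Matrix.specialUnitaryGroup (Fin 2) ℂ) : Matrix (Fin 2) (Fin 2) ℂ)
  | x, [] => by simp [walk, walkEnd, holAt_nil]
  | x, (μ, true) :: w => by
    have ih := parallel_transport hc (x.shift μ) w
    have h := hc ⟨x, μ⟩
    simp only [walk, walkEnd, holAt_cons, if_true, Submonoid.coe_mul, star_mul]
    change c x = _ * c (x.shift μ) * _ at h
    rw [h, ih]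
    simp only [mul_assoc]
  | x, (μ, false) :: w => by
    have ih := parallel_transport hc (x.unshift μ) w
    have h := hc ⟨x.unshift μ, μ⟩
    have hx : (⟨x.unshift μ, μ⟩ : PBond P 0).tgt = x := Site.shift_unshift x μ
    rw [hx] at h
    change c (x.unshift μ) = _ * c x * _ at h
    have hmem : ((V ⟨x.unshift μ, μ⟩ : Matrix.specialUnitaryGroup (Fin 2) ℂ) : Matrix (Fin 2) (Fin 2) ℂ) ∈ Matrix.unitaryGroup (Fin 2) ℂ :=
      (Matrix.mem_specialUnitaryGroup_iff.1 (V ⟨x.unshift μ, μ⟩).2).1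
    have hsu : star ((V ⟨x.unshift μ, μ⟩ : Matrix.specialUnitaryGroup (Fin 2) ℂ) : Matrix (Fin 2) (Fin 2) ℂ) *
        ((V ⟨x.unshift μ, μ⟩ : Matrix.specialUnitaryGroup (Fin 2) ℂ) : Matrix (Fin 2) (Fin 2) ℂ) = 1 := Unitary.star_mul_self_of_mem hmem
    have hinv : (((V ⟨x.unshift μ, μ⟩)⁻¹ : Matrix.specialUnitaryGroup (Fin 2) ℂ) : Matrix (Fin 2) (Fin 2) ℂ) =
        star ((V ⟨x.unshift μ, μ⟩ : Matrix.specialUnitaryGroup (Fin 2) ℂ) : Matrix (Fin 2) (Fin 2) ℂ) := rfl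
    -- `c x = V⋆ · c(x − e_μ) · V`
    have hcx : c x = star ((V ⟨x.unshift μ, μ⟩ : Matrix.specialUnitaryGroup (Fin 2) ℂ) : Matrix (Fin 2) (Fin 2) ℂ) * c (x.unshift μ) *
        ((V ⟨x.unshift μ, μ⟩ : Matrix.specialUnitaryGroup (Fin 2) ℂ) : Matrix (Fin 2) (Fin 2) ℂ) := by
      rw [h]
      simp only [← mul_assoc, hsu, one_mul]
      rw [mul_assoc, hsu, mul_one]
    simp only [walk, walkEnd, holAt_cons, Bool.false_eq_true, if_false, Submonoid.coe_mul, star_mul, hinv, star_star]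
    rw [hcx, ih]
    simp only [mul_assoc]

/-- ★★ **THE «p = 3» READING**: if the values at the base site `x₀` of a family of `V`-parallel sections SPAN `M₂(ℂ)` (e.g. `1` and three independent traceless-Hermitian
parallel sections), then every closed-walk holonomy of `V` at `x₀` is CENTRAL — the datum `hcen` of `exists_gauge_centralValued_of_loopHol_central`
(`Ad_{V(γ)}` fixes each `c_i(x₀)` by transport around the closed walk, hence fixes their span). [cite: Balaban1985BackgroundPropagators, (3.21) p.394] -/
theorem loopHol_central_of_parallel_span (x₀ : Site P 0) {ι : Type*} (c : ι → Site P 0 → Matrix (Fin 2) (Fin 2) ℂ)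
    (hc : ∀ (i : ι) (e : PBond P 0), c i e.src = ((V e : Matrix.specialUnitaryGroup (Fin 2) ℂ) : Matrix (Fin 2) (Fin 2) ℂ) * c i e.tgt *
      star ((V e : Matrix.specialUnitaryGroup (Fin 2) ℂ) : Matrix (Fin 2) (Fin 2) ℂ))
    (hspan : ∀ M : Matrix (Fin 2) (Fin 2) ℂ, M ∈ Submodule.span ℂ (Set.range fun i => c i x₀)) :
    ∀ w : List (Letter P.d), walkEnd x₀ w = x₀ →
      ∀ M : Matrix (Fin 2) (Fin 2) ℂ, Commute ((holAt V (walk x₀ w) : Matrix.specialUnitaryGroup (Fin 2) ℂ) : Matrix (Fin 2) (Fin 2) ℂ) M := by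
  intro w hw M
  set H : Matrix (Fin 2) (Fin 2) ℂ := ((holAt V (walk x₀ w) : Matrix.specialUnitaryGroup (Fin 2) ℂ) : Matrix (Fin 2) (Fin 2) ℂ) with hH
  have hmem : H ∈ Matrix.unitaryGroup (Fin 2) ℂ := (Matrix.mem_specialUnitaryGroup_iff.1 (holAt V (walk x₀ w)).2).1
  have hsu : star H * H = 1 := Unitary.star_mul_self_of_mem hmem
  -- each base value commutes with `H`
  have hci : ∀ i, Commute H (c i x₀) := by
    intro i
    have ht := parallel_transport V (hc i) x₀ w
    rw [hw] at ht
    -- `c = H c H⋆` ⇒ `c H = H c`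
    have : c i x₀ * H = H * c i x₀ := by
      conv_lhs => rw [ht]
      rw [mul_assoc, hsu, mul_one]
    exact this.symm
  -- hence `H` commutes with the span
  refine Submodule.span_induction (p := fun M _ => Commute H M) ?_ ?_ ?_ ?_ (hspan M)
  · rintro _ ⟨i, rfl⟩; exact hci i
  · exact Commute.zero_right H
  · intro a b _ _ ha hb; exact ha.add_right hb
  · intro z a _ ha; exact ha.smul_right z

end Reading

/-! ## §4 At the `d = 3` family: the symmetric regular centre for a coarse field with central holonomies -/

section T3

open Literature.MathematicalPhysics.QuantumFieldTheory.Balaban1983to89.T3ContinuumYM3Torus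
open T3UnitLawDensityEML (ℰp)
open T3ConstrainedMinimiser (fibre)
open T3PrintedRegularMinimiser (RegPr)
open T3SectALandauChart (bgUnits CloseAvg)
open B15DeterminingSets (embIter)
open Summit.QuantumFields.YangMills.Theorems.Prop8Chart (emlIterU)
open Summit.QuantumFields.YangMills.Theorems.Prop7SymCentreCentral (exists_symCentre_of_central_gauge)

variable (F : T3Family) {n K : ℕ}

/-- ★★★ **SYM-CENTRE, CASE (a) «CENTRAL HOLONOMIES» (`p(V) = 3`), END TO END**: if every closed-walk holonomy of the coarse field `V` (at one base site) is central and
`V` has `2`-small plaquettes, then the fibre of `V` contains a printed-regular configuration `U₀` (every radius `a > 0`), `b`-close to `V` in average (every `b > 0`), for which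
EVERY `Ū₀`-parallel coarse section lifts (`hLift`) — ✓`exists_symCentre_of_central_gauge` (★px6 g3, the face section of the central-valued normal form) ∘ §2.
[cite: Balaban1985Averaging, (8)-(12) p.19; Balaban1987RG1, (0.4) p.253] -/
theorem exists_symCentre_of_loopHol_central (h : n ≤ K) (V : GaugeField (F.P n) 0 (Matrix.specialUnitaryGroup (Fin 2) ℂ))
    (x₀ : Site (F.P n) 0)
    (hcen : ∀ w : List (Letter (F.P n).d), walkEnd x₀ w = x₀ →
      ∀ M : Matrix (Fin 2) (Fin 2) ℂ, Commute ((holAt V (walk x₀ w) : Matrix.specialUnitaryGroup (Fin 2) ℂ) : Matrix (Fin 2) (Fin 2) ℂ) M)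
    {δ : ℝ} (hδ : δ ≤ 2) (hV : PlaqSmall δ V) {a b : ℝ} (ha : 0 < a) (hb : 0 < b) :
    ∃ U₀ : GaugeField (F.P K) 0 (Matrix.specialUnitaryGroup (Fin 2) ℂ),
      U₀ ∈ fibre F ℰp n K h V ∧ RegPr F n K a U₀ ∧ CloseAvg F n K h b V U₀ ∧
      ∀ cf : Site (F.P K) (K - n) → Matrix (Fin 2) (Fin 2) ℂ,
        (∀ e : PBond (F.P K) (K - n), cf e.src = ((emlIterU (K - n) (bgUnits F K U₀) e : (Matrix (Fin 2) (Fin 2) ℂ)ˣ) : Matrix (Fin 2) (Fin 2) ℂ) * cf e.tgt *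
          (((emlIterU (K - n) (bgUnits F K U₀) e)⁻¹ : (Matrix (Fin 2) (Fin 2) ℂ)ˣ) : Matrix (Fin 2) (Fin 2) ℂ)) →
        ∃ l₀ : Site (F.P K) 0 → Matrix (Fin 2) (Fin 2) ℂ,
          (∀ b' : PBond (F.P K) 0, l₀ b'.src = ((bgUnits F K U₀ b' : (Matrix (Fin 2) (Fin 2) ℂ)ˣ) : Matrix (Fin 2) (Fin 2) ℂ) * l₀ b'.tgt * (((bgUnits F K U₀ b')⁻¹ : (Matrix (Fin 2) (Fin 2) ℂ)ˣ) : Matrix (Fin 2) (Fin 2) ℂ)) ∧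
          ∀ y : Site (F.P K) (K - n), l₀ (embIter (K - n) y) = cf y :=
  exists_symCentre_of_central_gauge F h hδ (exists_gauge_centralValued_of_loopHol_central V x₀ hcen hV) ha hb

end T3

end Summit.QuantumFields.YangMills.Theorems.Prop7SymCentreCentralGauge

end
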